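import Summits.HodgeConjecture.HodgeConjecture.Theorems.R90S10ArchSignKitDefs        -- ★ carriers `GInf ∕ HInf ∕ phi3` (= ★ C2's `GArch ∕ HArch`, `ArchOrbFamG∕H` by `abbrev`)
import Literature.NumberTheory.Rogawski1990.ArchCompatibleFamiliesGExist           -- ★ `exists_archCompatibleFamiliesG_haar` ((W)(C) on `G_∞` through an auxiliary anisotropic form)
import Literature.NumberTheory.Rogawski1990.ArchCentralizerHaarMeasures             -- ★ `exists_archCompatibleFamiliesH` (the `H_∞` half for given torus measures)
import HarnessLib

/-!
# R90-TF · S10 (Rogawski 1990 §13.8) · THEOREMS — `R90S10ArchFamiliesOfT2Frame`: PRINT'S ARCHIMEDEAN MEASURE FRAME EXISTS AT THE QUASI-SPLIT PAIR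
# `(G_∞, H_∞) = (U(Φ₃), U(Φ₂) × U(Φ₁))(L⁺ ⊗ ℝ)` — the first three binders `hW hC hWH` of S2's socket T2 (= the R6 block `mGi mHi tGi tHi hWG hWH` of ★ `S10HDatum`)

Cell hodgecm-mathlib, slab R90-TF, section S10 = §13.8, crux item h413 = stmt-HodgeConjecture-24833 (route `route-HodgeConjecture-HCCMUnconditional`).  Prover seat
R90-C138-p05 (g0), DEAL #46 (R90-C138-plan (g3), 2026-09-05T02:22Z): junction J-R6 of typ3's PAYER TABLE e9eb8b61 — «do the R6 fields `νGi νHi tGi tHi mGi mHi hWG hWH` of ★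
`S10HDatum` and the frame binders `hW hC hWH` of S2's T2 `stub_R90_S2_archBlockPacketCusp` agree?».  ANSWER (census `R90/R90-C138-p05/g0/CENSUS-JR6-archFrame.md`): (J-R6-a) YES,
TOKEN FOR TOKEN — `GArch L := GInf L`, `HArch L := HInf L`, `ArchOrbFamG L := @OrbitalMeasureFamily (GArch L) _ (fun _ => borel _)` are reducible ★ abbreviations of T2's
carriers under T2's own `letI … := fun _ => borel _` preamble, `hWG`'s body IS `hW` and `hWH` IS `hWH`; so the payer of `sock_S10_realiseH₂` sets `mGi := mG, mHi := mH, νGi := ν,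
νHi := νH, tGi := t, tHi := tH, hWG := hW, hWH := hWH` and reads R8.3∕R8.4 off T2 BY NAME.  What the payer must still PRODUCE is the frame itself — and THIS FILE produces it:
for all Haar `ν`, `νH` on `G_∞`, `H_∞` there EXIST `mH mG tH t` with (W) Weil form `mG = dν∕dt` at the regular classes, (C) transport of `t` under stable conjugacy inside
`G_∞`, and (W_H)+(C_H) ★ `ArchCompatibleFamiliesH L νH mH tH t` — T2's binders `hW hC hWH` VERBATIM.  (T2's two further binders `hnd : IsArchNondegenerate …` and `h5 :
IsArchDeltaTransferExists …` are NOT measure-frame data: they are the non-degeneracy of `Δ″_∞` and Shelstad's archimedean transfer (E5, S6's `sock_S6_ext_archTransferShelstad`) —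
named honestly as the residual of the T2 junction, not of R6.)

PRINT → PROOF (Rogawski 1990 §1.7 p. 6 «all measures on groups are assumed to be Haar measures … compatible»; §4.3 (4.3.1) p. 43 «the orbital integrals are defined using
compatible measures on `H_{γ′}` and `G_γ`»; §14.2 (14.2.1) pp. 232–233; [Shelstad1979, §4 p. 20]; [LanglandsShelstad1987, (1.3)–(1.4)]).  ★ `exists_archCompatibleFamiliesG_haar`
(Literature `ArchCompatibleFamiliesGExist`) builds, for ANY auxiliary anisotropic hermitian `H′` and right-invariant locally finite `ν′`, `ν`, a Weil-form system on `U(H′)_∞ ∕ U(Φ₃)_∞`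
whose `G_∞`-half is exactly (W)+(C), with torus measures Haar at every regular element; we run it at the auxiliary form `H′ := 1` (anisotropic over the CM field `L`: ★
`UnitaryGroup.anisotropic_of_posDef_map` at any complex embedding, `1` is positive definite) with `ν′ := 0` (the `G′`-half is discarded), and feed the torus measures `t` to ★
`exists_archCompatibleFamiliesH` (Literature `ArchCentralizerHaarMeasures`: (W_H) by the Weil-form constructor, (C_H) by transport along `ι_∞|_{Z(γ_H)}`).  Pure measure theory;
no representation theory, no transfer statement.

CONTENTS (theorems only; no `def`, no `instance`, no `notation`, no `sorry`; axioms ⊆ {propext, Classical.choice, Quot.sound}).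
* `anisotropic_one L N` — the identity hermitian form on `L^N` is anisotropic (`Σ x_i x̄_i = 0 ⇒ x = 0`).
* `exists_archFrame_T2 L ν νH` — `∃ mH mG tH t, hW ∧ hC ∧ ArchCompatibleFamiliesH L νH mH tH t`, binders and body in T2's bytes (S2 D ED. 2 `Lines/R90_S2_ArchBlockPacketLetterD.lean`
  13ac8d02 :91–:126 ∕ ★ `archSignKitCusp_of_archBlockPacketCusp` :72–:106), under T2's `letI … borel` preamble.
* `exists_archFrame_T2_haar L ν νH` — the same WITH the rider «`t γ` is a Haar, inversion-invariant measure on `Z(γ)` at every regular `γ`» (what a (κ)-type consumer reads).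
NON-VACUITY: Haar measures on `G_∞`, `H_∞` exist (locally compact groups); the produced `t γ` are genuine Haar measures at regular `γ` (rider), `mG`∕`mH` are the invariant
quotients there (junk `0` only off the regular ∕ `G`-regular classes, never read by (W)(W_H)).

HONEST LABEL: this brick supplies the MEASURE FRAME only (R6 + T2's `hW hC hWH`); it pays no socket; T2 itself, `hnd`, `h5`, R2, R3, R7 remain where the payer table puts them.
HC_CM is proved only modulo the 7 printed citations (2 remaining named inputs: hLiu418 = stmt-HodgeConjecture-24832, h413 = stmt-HodgeConjecture-24833) until rung 0 closes;
count-neutral helper; REL ≠ ★ ≠ BUILT.  Namespace `Summit.HodgeConjecture.HodgeConjecture.R90.S10`.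

## References
* [Rogawski1990] J. D. Rogawski, *Automorphic Representations of Unitary Groups in Three Variables*, Ann. of Math. Stud. 123 (1990): §1.7 p. 6; §4.3 (4.3.1) p. 43; §14.2
  (14.2.1) pp. 232–233; §13.8 p. 218.
* [Shelstad1979] D. Shelstad, *Characters and inner forms of a quasi-split group over ℝ*, Compositio Math. 39 (1979), §4 p. 20.
* [LanglandsShelstad1987] R. P. Langlands, D. Shelstad, *On the definition of transfer factors*, Math. Ann. 278 (1987), §1.3–1.4.
* [DeitmarEchterhoff2014] A. Deitmar, S. Echterhoff, *Principles of Harmonic Analysis*, 2nd ed. (2014), Thm. 1.5.3.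
* [PlatonovRapinchuk1994] V. Platonov, A. Rapinchuk, *Algebraic Groups and Number Theory* (1994), §2.3 (anisotropic hermitian forms).
-/

set_option autoImplicit false
-- the mandated namespace repeats the single-problem summit's segment (`HodgeConjecture.HodgeConjecture`)
set_option linter.dupNamespace false

noncomputable section

open NumberField MeasureTheory
open scoped Matrix MatrixGroups ComplexOrder
open Literature.NumberTheory.Automorphic Literature.NumberTheory.Rogawski1990
open Literature.AlgebraicGeometry.ShimuraVarieties (hermForm)

namespace Summit.HodgeConjecture.HodgeConjecture.R90.S10

variable (L : Type) [Field L] [NumberField L] [IsCMField L]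

/-- **The identity hermitian form `Σ_i x_i x̄_i` on `L^N` is ANISOTROPIC over the CM field `L`**: at any complex embedding `τ` it is positive definite (★
`UnitaryGroup.anisotropic_of_posDef_map`; Mathlib `Matrix.PosDef.one`).  The auxiliary compact inner form through which ★ `exists_archCompatibleFamiliesG_haar` is run.
[cite: PlatonovRapinchuk1994, §2.3] -/
theorem anisotropic_one (N : ℕ) : ∀ x : Fin N → L, hermForm (cmConjRingHom L) (1 : Matrix (Fin N) (Fin N) L) x x = 0 → x = 0 := by
  obtain ⟨τ⟩ := (inferInstance : Nonempty (L →+* ℂ))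
  refine UnitaryGroup.anisotropic_of_posDef_map L (1 : Matrix (Fin N) (Fin N) L) τ ?_
  rw [Matrix.map_one τ (map_zero τ) (map_one τ)]
  exact Matrix.PosDef.one

/-- **PRINT'S ARCHIMEDEAN MEASURE FRAME EXISTS AT `(U(Φ₃), U(Φ₂) × U(Φ₁))(L⁺ ⊗ ℝ)` — T2's binders `hW hC hWH` VERBATIM, with the Haar rider.**  For all Haar `ν` on `G_∞` and `νH`
on `H_∞`: orbital measure families `mH`, `mG` (Borel orbit-quotient σ-algebras) and centraliser measures `tH`, `t` with (W) `mG = dν ∕ dt` at the regular classes (★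
`IsQuotientOf`), (C) `t` transported under stable conjugacy inside `G_∞` (★ `archStableCentralizerEquiv`), (W_H)+(C_H) ★ `ArchCompatibleFamiliesH L νH mH tH t`, AND `t γ` Haar and
inversion-invariant at every regular `γ`.  Proof: ★ `exists_archCompatibleFamiliesG_haar` at the auxiliary anisotropic form `1` (`anisotropic_one`; auxiliary measure `0`,
its `G′`-half discarded) + ★ `exists_archCompatibleFamiliesH`. [cite: Rogawski1990, §1.7 p. 6; §4.3 (4.3.1) p. 43; §14.2 (14.2.1) pp. 232–233] [cite: Shelstad1979, §4 p. 20]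
[cite: LanglandsShelstad1987, §1.3–1.4] [cite: DeitmarEchterhoff2014, Thm. 1.5.3] -/
theorem exists_archFrame_T2_haar
    [MeasurableSpace (GInf L)] [BorelSpace (GInf L)] (ν : Measure (GInf L)) [ν.IsHaarMeasure] [ν.IsMulRightInvariant]
    [MeasurableSpace (HInf L)] [BorelSpace (HInf L)] (νH : Measure (HInf L)) [νH.IsHaarMeasure] [νH.IsMulRightInvariant] :
    letI : ∀ a : HInf L, MeasurableSpace (HInf L ⧸ Subgroup.centralizer ({a} : Set (HInf L))) := fun _ => borel _
    haveI : ∀ a : HInf L, BorelSpace (HInf L ⧸ Subgroup.centralizer ({a} : Set (HInf L))) := fun _ => ⟨rfl⟩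
    letI : ∀ γ : GInf L, MeasurableSpace (GInf L ⧸ Subgroup.centralizer ({γ} : Set (GInf L))) := fun _ => borel _
    haveI : ∀ γ : GInf L, BorelSpace (GInf L ⧸ Subgroup.centralizer ({γ} : Set (GInf L))) := fun _ => ⟨rfl⟩
    ∃ (mH : OrbitalMeasureFamily (HInf L)) (mG : OrbitalMeasureFamily (GInf L))
      (tH : ∀ a : HInf L, Measure (Subgroup.centralizer ({a} : Set (HInf L))))
      (t : ∀ γ : GInf L, Measure (Subgroup.centralizer ({γ} : Set (GInf L)))),
      mG.IsQuotientOf (fun γ => IsRegularElt (γ.val : GL (Fin 3) (mixedEmbedding.mixedSpace L))) ν t ∧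
      (∀ (γ₁ γ₂ : GInf L)
          (h₁ : IsRegularElt (γ₁.val : GL (Fin 3) (mixedEmbedding.mixedSpace L)))
          (hc : Corresponds (UnitaryGroup.conjMixed (↥(maximalRealSubfield L)) L (IsCMField.complexConj L))
            (UnitaryGroup.archFormOf L 3 (phi3 L)) (UnitaryGroup.archFormOf L 3 (phi3 L)) γ₁ γ₂),
          Measure.map ⇑(UnitaryGroup.archStableCentralizerEquiv L (UnitaryGroup.isUnit_antidiagOne_det L 3).ne_zero
            (UnitaryGroup.isUnit_antidiagOne_det L 3).ne_zero hc h₁) (t γ₁) = t γ₂) ∧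
      ArchCompatibleFamiliesH L νH mH tH t ∧
      (∀ γ : GInf L, IsRegularElt (γ.val : GL (Fin 3) (mixedEmbedding.mixedSpace L)) → (t γ).IsHaarMeasure ∧ (t γ).IsInvInvariant) := by
  letI : MeasurableSpace (UnitaryGroup.arch (↥(maximalRealSubfield L)) L (IsCMField.complexConj L) 3 (1 : Matrix (Fin 3) (Fin 3) L)) := borel _
  haveI : BorelSpace (UnitaryGroup.arch (↥(maximalRealSubfield L)) L (IsCMField.complexConj L) 3 (1 : Matrix (Fin 3) (Fin 3) L)) := ⟨rfl⟩
  haveI : IsFiniteMeasureOnCompacts (0 : Measure (UnitaryGroup.arch (↥(maximalRealSubfield L)) L (IsCMField.complexConj L) 3 (1 : Matrix (Fin 3) (Fin 3) L))) :=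
    ⟨fun K _ => by simp⟩
  haveI : (0 : Measure (UnitaryGroup.arch (↥(maximalRealSubfield L)) L (IsCMField.complexConj L) 3 (1 : Matrix (Fin 3) (Fin 3) L))).IsMulRightInvariant :=
    ⟨fun g => by simp⟩
  obtain ⟨-, m, -, t, ⟨-, hW, -, hC, -⟩, -, ht⟩ :=
    exists_archCompatibleFamiliesG_haar L (1 : Matrix (Fin 3) (Fin 3) L) (0 : Measure _) ν (anisotropic_one L 3)
  obtain ⟨mH, tH, hWH⟩ := exists_archCompatibleFamiliesH L νH t fun γ h => (ht γ h).1
  exact ⟨mH, m, tH, t, hW, hC, hWH, ht⟩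

/-- **T2's FRAME BINDERS `hW hC hWH` EXIST, VERBATIM** (S2 D ED. 2 `stub_R90_S2_archBlockPacketCusp` :91–:126 ∕ ★ `archSignKitCusp_of_archBlockPacketCusp`'s `hT2`): for all Haar `ν`,
`νH` there are `mH mG tH t` with (W), (C), (W_H)+(C_H).  By the J-R6 identification (`GArch = GInf`, `ArchOrbFamG L = OrbitalMeasureFamily (GInf L)` at `borel`, reducibly) these ARE
the R6 fields `mGi mHi tGi tHi hWG hWH` of ★ `S10HDatum` at `νGi := ν`, `νHi := νH` — so the payer of `sock_S10_realiseH₂` fills R6 from here and instantiates T2 at the same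
frame, reading R8.3∕R8.4 BY NAME. [cite: Rogawski1990, §1.7 p. 6; §4.3 (4.3.1) p. 43; §13.8 p. 218] [cite: Shelstad1979, §4 p. 20] [cite: LanglandsShelstad1987, §1.3–1.4] -/
theorem exists_archFrame_T2
    [MeasurableSpace (GInf L)] [BorelSpace (GInf L)] (ν : Measure (GInf L)) [ν.IsHaarMeasure] [ν.IsMulRightInvariant]
    [MeasurableSpace (HInf L)] [BorelSpace (HInf L)] (νH : Measure (HInf L)) [νH.IsHaarMeasure] [νH.IsMulRightInvariant] :
    letI : ∀ a : HInf L, MeasurableSpace (HInf L ⧸ Subgroup.centralizer ({a} : Set (HInf L))) := fun _ => borel _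
    haveI : ∀ a : HInf L, BorelSpace (HInf L ⧸ Subgroup.centralizer ({a} : Set (HInf L))) := fun _ => ⟨rfl⟩
    letI : ∀ γ : GInf L, MeasurableSpace (GInf L ⧸ Subgroup.centralizer ({γ} : Set (GInf L))) := fun _ => borel _
    haveI : ∀ γ : GInf L, BorelSpace (GInf L ⧸ Subgroup.centralizer ({γ} : Set (GInf L))) := fun _ => ⟨rfl⟩
    ∃ (mH : OrbitalMeasureFamily (HInf L)) (mG : OrbitalMeasureFamily (GInf L))
      (tH : ∀ a : HInf L, Measure (Subgroup.centralizer ({a} : Set (HInf L))))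
      (t : ∀ γ : GInf L, Measure (Subgroup.centralizer ({γ} : Set (GInf L)))),
      mG.IsQuotientOf (fun γ => IsRegularElt (γ.val : GL (Fin 3) (mixedEmbedding.mixedSpace L))) ν t ∧
      (∀ (γ₁ γ₂ : GInf L)
          (h₁ : IsRegularElt (γ₁.val : GL (Fin 3) (mixedEmbedding.mixedSpace L)))
          (hc : Corresponds (UnitaryGroup.conjMixed (↥(maximalRealSubfield L)) L (IsCMField.complexConj L))
            (UnitaryGroup.archFormOf L 3 (phi3 L)) (UnitaryGroup.archFormOf L 3 (phi3 L)) γ₁ γ₂),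
          Measure.map ⇑(UnitaryGroup.archStableCentralizerEquiv L (UnitaryGroup.isUnit_antidiagOne_det L 3).ne_zero
            (UnitaryGroup.isUnit_antidiagOne_det L 3).ne_zero hc h₁) (t γ₁) = t γ₂) ∧
      ArchCompatibleFamiliesH L νH mH tH t := by
  obtain ⟨mH, mG, tH, t, hW, hC, hWH, -⟩ := exists_archFrame_T2_haar L ν νH
  exact ⟨mH, mG, tH, t, hW, hC, hWH⟩

end Summit.HodgeConjecture.HodgeConjecture.R90.S10

end
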